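import Summits.RiemannHypothesis.RiemannHypothesis.Theorems.Splittings.RobinFiniteHeightLaw
import HarnessLib

/-!
# RobinFiniteThetaRel — gen 13 θ-CEILING LIFT, part 1/6 (R1a–R1b₁): RH-free relative `θ`-bounds; the short window re-read

Cell rh-split, seat rh-split-robin-finite g13 (card `cards/SPLIT-robin-finite.md` §20, «θ-CEILING LIFT WITH NO NEW INPUT»).
A use-site audit of the tree's exchange engine shows that above the `Q`-scale every `θ`-evaluation consumes only RELATIVE precision
— RH-free from the two named facts the engine already carries, Büthe 2018 Thm 2 (`x ≤ 10¹⁹`) and BKLNW 2021 §1.2 (`x ≥ 10¹⁹`) — except the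
E-side term `S²(x) = (θ(x) − x)²/(x² log x)`, which BKLNW bounds by `1.43641·10⁻⁹/log⁵x`.  Parts 1–6 re-read the engine accordingly: above
`2.5·10²²` NO Schoenfeld-form window, NO Büthe 2016, NO range condition `4.92·√(X/log X) ≤ T`; RH to height `T` enters only through the
zero side, and the budget acquires the `T`-independent S²-price `2.07·10⁻¹⁶·√X` (BKLNW ceiling `X ≲ 5.5·10³⁰`).

This part (0 `def`): `abs_theta_sub_le_free` (`|θ(t) − t| ≤ c·t` for `t ≥ 1423` when `1.95 ≤ c√t`, `3.79·10⁻⁵ ≤ c`), the six relative bounds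
`theta_{ge,le}_{975,99947,9998}R` (`t ≥ 2¹⁵, 2³⁰, 2³⁴`), `thetaP_boundsR`; and the G-side short window re-read `window_boundR`, `window_caseBR`
(bodies of the tree's `window_boundW`, `window_caseBW` VERBATIM with `hW … (≤ B)` ↦ `h18 h21`).

HONEST LABEL: SPLITTING SEARCH over kernel-typed RH-EQUIVALENCES; a splitting A ∧ B ⟹ RH is CONDITIONAL
bookkeeping unless A and B are both proved; nothing here bears on the truth of RH.
-/

set_option linter.dupNamespace false

noncomputable section

namespace Summit.RiemannHypothesis.RiemannHypothesis.Theorems.Splittings.RobinFiniteE3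

open Real Filter Finset
open scoped Chebyshev
open Literature.NumberTheory.LFunctions Literature.NumberTheory.DiophantineGeometry
open RobinAnalyticSharp

section LargePRel
open RobinAnalytic

/-! ### R1a · RH-free relative `θ`-bounds from Büthe 2018 Thm 2 (`x ≤ 10¹⁹`) and BKLNW 2021 §1.2 (`x ≥ 10¹⁹`) -/

/-- **RH-free relative `θ`-bound**: `|θ(t) − t| ≤ c·t` for `t ≥ 1423` whenever `1.95 ≤ c·√t` (Büthe 2018 Thm 2 below `10¹⁹`)
and `3.79·10⁻⁵ ≤ c` (BKLNW 2021 §1.2, `k = 2`, above `10¹⁹`; `log²t ≥ 1`).  Both facts in hypothesis position. -/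
theorem abs_theta_sub_le_free (h18 : Buthe2018_thm2_theta) (h21 : BroadbentEtAl2021_theta_rel_1e19)
    {t c : ℝ} (ht : 1423 ≤ t) (hc1 : 1.95 ≤ c * √t) (hc2 : 3.79e-5 ≤ c) : |θ t - t| ≤ c * t := by
  have ht0 : 0 < t := by linarith
  rcases le_or_gt t ((10 : ℝ) ^ 19) with h19 | h19
  · have h1 := h18.abs_sub_le ht h19
    have hs0 : 0 ≤ √t := Real.sqrt_nonneg t
    calc |θ t - t| ≤ 1.95 * √t := h1
      _ ≤ (c * √t) * √t := mul_le_mul_of_nonneg_right hc1 hs0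
      _ = c * t := by rw [mul_assoc, Real.mul_self_sqrt ht0.le]
  · have h1 := h21.abs_sub_lt h19.le
    have hlog : 1 ≤ Real.log t := by
      rw [← Real.log_exp 1]
      refine Real.log_le_log (Real.exp_pos 1) ?_
      have := Real.exp_one_lt_d9
      linarith
    have hl2 : 1 ≤ Real.log t ^ 2 := by nlinarith
    have h' : 3.79e-5 * t / Real.log t ^ 2 ≤ 3.79e-5 * t := by
      rw [div_le_iff₀ (by positivity)]; nlinarith
    have h'' : 3.79e-5 * t ≤ c * t := mul_le_mul_of_nonneg_right hc2 ht0.le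
    linarith [h1.le]

/-- `θ(t) ≥ 0.975 t` for `t ≥ 2¹⁵`, RH-free (`√t ≥ 78`, `c = 0.025`). -/
theorem theta_ge_975R (h18 : Buthe2018_thm2_theta) (h21 : BroadbentEtAl2021_theta_rel_1e19) {t : ℝ}
    (ht : (2 : ℝ) ^ 15 ≤ t) : 0.975 * t ≤ θ t := by
  have hs : (78 : ℝ) ≤ √t := Real.le_sqrt_of_sq_le (le_trans (by norm_num) ht)
  have h := abs_theta_sub_le_free h18 h21 (c := 0.025) (le_trans (by norm_num) ht) (by linarith) (by norm_num)
  have := (abs_le.1 h).1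
  linarith

/-- `θ(t) ≤ 1.025 t` for `t ≥ 2¹⁵`, RH-free. -/
theorem theta_le_1025R (h18 : Buthe2018_thm2_theta) (h21 : BroadbentEtAl2021_theta_rel_1e19) {t : ℝ}
    (ht : (2 : ℝ) ^ 15 ≤ t) : θ t ≤ 1.025 * t := by
  have hs : (78 : ℝ) ≤ √t := Real.le_sqrt_of_sq_le (le_trans (by norm_num) ht)
  have h := abs_theta_sub_le_free h18 h21 (c := 0.025) (le_trans (by norm_num) ht) (by linarith) (by norm_num)
  have := (abs_le.1 h).2
  linarith

/-- `θ(t) ≥ 0.99947 t` for `t ≥ 2³⁰`, RH-free (`√t ≥ 2¹⁵`, `c = 0.00053`). -/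
theorem theta_ge_99947R (h18 : Buthe2018_thm2_theta) (h21 : BroadbentEtAl2021_theta_rel_1e19) {t : ℝ}
    (ht : (2 : ℝ) ^ 30 ≤ t) : 0.99947 * t ≤ θ t := by
  have hs : (32768 : ℝ) ≤ √t := Real.le_sqrt_of_sq_le (le_trans (by norm_num) ht)
  have h := abs_theta_sub_le_free h18 h21 (c := 0.00053) (le_trans (by norm_num) ht) (by linarith) (by norm_num)
  have := (abs_le.1 h).1
  linarith

/-- `θ(t) ≤ 1.00053 t` for `t ≥ 2³⁰`, RH-free. -/
theorem theta_le_100053R (h18 : Buthe2018_thm2_theta) (h21 : BroadbentEtAl2021_theta_rel_1e19) {t : ℝ}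
    (ht : (2 : ℝ) ^ 30 ≤ t) : θ t ≤ 1.00053 * t := by
  have hs : (32768 : ℝ) ≤ √t := Real.le_sqrt_of_sq_le (le_trans (by norm_num) ht)
  have h := abs_theta_sub_le_free h18 h21 (c := 0.00053) (le_trans (by norm_num) ht) (by linarith) (by norm_num)
  have := (abs_le.1 h).2
  linarith

/-- `θ(t) ≥ 0.9998 t` for `t ≥ 2³⁴`, RH-free (`√t ≥ 2¹⁷`, `c = 0.0002`). -/
theorem theta_ge_9998R (h18 : Buthe2018_thm2_theta) (h21 : BroadbentEtAl2021_theta_rel_1e19) {t : ℝ}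
    (ht : (2 : ℝ) ^ 34 ≤ t) : 0.9998 * t ≤ θ t := by
  have hs : (131072 : ℝ) ≤ √t := Real.le_sqrt_of_sq_le (le_trans (by norm_num) ht)
  have h := abs_theta_sub_le_free h18 h21 (c := 0.0002) (le_trans (by norm_num) ht) (by linarith) (by norm_num)
  have := (abs_le.1 h).1
  linarith

/-- `θ(t) ≤ 1.0002 t` for `t ≥ 2³⁴`, RH-free. -/
theorem theta_le_10002R (h18 : Buthe2018_thm2_theta) (h21 : BroadbentEtAl2021_theta_rel_1e19) {t : ℝ}
    (ht : (2 : ℝ) ^ 34 ≤ t) : θ t ≤ 1.0002 * t := by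
  have hs : (131072 : ℝ) ≤ √t := Real.le_sqrt_of_sq_le (le_trans (by norm_num) ht)
  have h := abs_theta_sub_le_free h18 h21 (c := 0.0002) (le_trans (by norm_num) ht) (by linarith) (by norm_num)
  have := (abs_le.1 h).2
  linarith

/-- `0.9998 P ≤ θ(P) ≤ 1.0002 P` for naturals `P ≥ 2·10¹⁰`, RH-free (cf. `thetaP_boundsW`). -/
theorem thetaP_boundsR (h18 : Buthe2018_thm2_theta) (h21 : BroadbentEtAl2021_theta_rel_1e19) {P : ℕ}
    (hP : (2 * 10 ^ 10 : ℝ) ≤ P) : 0.9998 * P ≤ θ P ∧ θ P ≤ 1.0002 * P :=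
  ⟨theta_ge_9998R h18 h21 (P_ge_2pow34 hP), theta_le_10002R h18 h21 (P_ge_2pow34 hP)⟩

/-! ### R1b · the G-side of the engine re-read RH-free (tree bodies verbatim; `hW … (≤ B)` ↦ `h18 h21`) -/

/-- R1 · `window_boundW` re-read RH-free (gen 13): `θ` at `n ≤ 20y` and at `y` by `theta_ge_975R` / `theta_le_1025R`; no `B`. -/
theorem window_boundR (h18 : Buthe2018_thm2_theta) (h21 : BroadbentEtAl2021_theta_rel_1e19) {y P Q : ℕ}
    (hy : (2 : ℝ) ^ 15 ≤ y) (hyP : 20 * y ≤ P) (hQy : Q ≤ y) :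
    0.827 / (y * Real.log (20 * y)) ≤
      ∑ p ∈ (Nat.primesLE P).filter (fun p => Q < p), ((p : ℝ) ^ 2)⁻¹ := by
  classical
  have hy1R : (32768 : ℝ) ≤ y := le_trans (by norm_num) hy
  have hy1 : 32768 ≤ y := by exact_mod_cast hy1R
  have hy0 : (0 : ℝ) < y := by linarith
  set z := 20 * y with hz
  have hyz : y ≤ z := by omega
  -- restrict to the primes in `(y, z]`
  have hsub : (Nat.primesLE z).filter (fun p => y < p) ⊆ (Nat.primesLE P).filter (fun p => Q < p) := by
    intro p hp
    obtain ⟨hp1, hyp⟩ := Finset.mem_filter.1 hp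
    obtain ⟨hpz, hp'⟩ := Nat.mem_primesLE.1 hp1
    exact Finset.mem_filter.2 ⟨Nat.mem_primesLE.2 ⟨hpz.trans hyP, hp'⟩, lt_of_le_of_lt hQy hyp⟩
  refine le_trans ?_ (Finset.sum_le_sum_of_subset_of_nonneg hsub fun p _ _ => by positivity)
  refine le_trans ?_ (layer_cake y z)
  -- pointwise: `#{y < p ≤ n} ≥ (0.975 n - 1.025 y)/log z`
  have hlogz : 0 < Real.log (20 * y) := Real.log_pos (by linarith)
  have hcount : ∀ n ∈ Ioc y z,
      (0.975 * n - 1.025 * y) / Real.log (20 * y) ≤ #((Nat.primesLE n).filter (fun p => y < p)) := by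
    intro n hn
    rw [Finset.mem_Ioc] at hn
    have hnR : (y : ℝ) + 1 ≤ n := by exact_mod_cast hn.1
    have hnz : (n : ℝ) ≤ 20 * y := by exact_mod_cast hn.2
    have hn15 : (2 : ℝ) ^ 15 ≤ n := by linarith
    have h1 := theta_sub_theta_le_card_mul_log y n
    have h2 := theta_ge_975R h18 h21 hn15
    have h3 := theta_le_1025R h18 h21 hy
    have hlogn : 0 < Real.log n := Real.log_pos (by linarith)
    have hlogn' : Real.log n ≤ Real.log (20 * y) := Real.log_le_log (by linarith) hnz
    set c : ℝ := (#((Nat.primesLE n).filter (fun p => y < p)) : ℝ) with hc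
    have hc0 : 0 ≤ c := by positivity
    by_cases hneg : (0.975 : ℝ) * n - 1.025 * y ≤ 0
    · exact le_trans (div_nonpos_of_nonpos_of_nonneg hneg hlogz.le) hc0
    push Not at hneg
    rw [div_le_iff₀ hlogz]
    calc 0.975 * n - 1.025 * y ≤ θ n - θ y := by linarith
      _ ≤ c * Real.log n := h1
      _ ≤ c * Real.log (20 * y) := by gcongr
  have hd0 : ∀ n ∈ Ioc y z, 0 ≤ (1 / ((n : ℝ) * (n + 1)) - 1 / (((n : ℝ) + 1) * (n + 2))) := by
    intro n hn
    rw [Finset.mem_Ioc] at hn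
    rw [weight_eq n (by omega)]
    positivity
  calc 0.827 / (y * Real.log (20 * y))
      ≤ ∑ n ∈ Ioc y z, (1 / ((n : ℝ) * (n + 1)) - 1 / (((n : ℝ) + 1) * (n + 2))) *
          ((0.975 * n - 1.025 * y) / Real.log (20 * y)) := by
        -- evaluate the telescoping sums
        have hsum : ∑ n ∈ Ioc y z, (1 / ((n : ℝ) * (n + 1)) - 1 / (((n : ℝ) + 1) * (n + 2))) *
            ((0.975 * n - 1.025 * y) / Real.log (20 * y)) =
            (0.975 * (2 / ((y : ℝ) + 2) - 2 / ((z : ℝ) + 2)) -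
              1.025 * y * (1 / (((y : ℝ) + 1) * (y + 2)) - 1 / (((z : ℝ) + 1) * (z + 2)))) /
              Real.log (20 * y) := by
          rw [← sum_mul_weight hyz, ← sum_weight hyz, Finset.mul_sum, Finset.mul_sum,
            ← Finset.sum_sub_distrib, Finset.sum_div]
          refine Finset.sum_congr rfl fun n _ => ?_
          ring
        rw [hsum, hz]
        push_cast
        rw [show (0.827 : ℝ) / (y * Real.log (20 * y)) = 0.827 / y / Real.log (20 * y) by
          rw [div_div]]
        exact div_le_div_of_nonneg_right (bracket_ge hy1R) hlogz.le
    _ ≤ ∑ n ∈ Ioc y z, (1 / ((n : ℝ) * (n + 1)) - 1 / (((n : ℝ) + 1) * (n + 2))) *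
          #((Nat.primesLE n).filter (fun p => y < p)) := by
        refine Finset.sum_le_sum fun n hn => ?_
        exact mul_le_mul_of_nonneg_left (hcount n hn) (hd0 n hn)

/-- R1 · `window_caseBW` re-read RH-free (gen 13): Case B (`Q ≤ √P/4`), `S ≥ 5.8/(√P log P)`; no `B`. -/
theorem window_caseBR (h18 : Buthe2018_thm2_theta) (h21 : BroadbentEtAl2021_theta_rel_1e19) {P Q : ℕ}
    (hP : (2 * 10 ^ 10 : ℝ) ≤ P) (hQ : (Q : ℝ) ≤ √(P : ℝ) / 4) :
    5.8 / (√(P : ℝ) * Real.log P) ≤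
      ∑ p ∈ (Nat.primesLE P).filter (fun p => Q < p), ((p : ℝ) ^ 2)⁻¹ := by
  have hL := logP_ge hP
  have hsP := sqrtP_ge hP
  have hsq := sq_sqrtP hP
  have hP0 := P_pos hP
  set y := ⌊√(P : ℝ) / 4⌋₊ with hy_def
  have hy1 : (y : ℝ) ≤ √(P : ℝ) / 4 := Nat.floor_le (by positivity)
  have hy2 : (35355 : ℕ) ≤ y := Nat.le_floor (by push_cast; linarith)
  have hy2R : (35355 : ℝ) ≤ y := by exact_mod_cast hy2
  have hy15 : (2 : ℝ) ^ 15 ≤ y := le_trans (by norm_num) hy2R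
  have hy0 : (0 : ℝ) < y := by linarith
  have hyP : 20 * y ≤ P := by
    have : (20 * y : ℝ) ≤ P := by nlinarith
    exact_mod_cast this
  have hQy : Q ≤ y := Nat.le_floor hQ
  have hw := window_boundR h18 h21 hy15 hyP hQy
  refine le_trans ?_ hw
  -- `y log(20y) ≤ (√P/4)(log 5 + log P/2)`
  have hlog20y : Real.log (20 * y) ≤ 1.6095 + Real.log P / 2 := by
    have h1 : Real.log (20 * y) ≤ Real.log (5 * √(P : ℝ)) :=
      Real.log_le_log (by positivity) (by linarith)
    have h5 : Real.log (5 * √(P : ℝ)) = Real.log 5 + Real.log P / 2 := by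
      rw [Real.log_mul (by norm_num) (ne_of_gt (by positivity)), log_sqrtP hP]
    have := Real.log_five_lt_d9
    linarith
  have hlog20y0 : 0 < Real.log (20 * y) := Real.log_pos (by linarith)
  rw [div_le_div_iff₀ (by positivity) (by positivity)]
  calc 5.8 * (y * Real.log (20 * y)) ≤ 5.8 * ((√(P : ℝ) / 4) * (1.6095 + Real.log P / 2)) := by
        gcongr
    _ ≤ 0.827 * (√(P : ℝ) * Real.log P) := by nlinarith

end LargePRel

end Summit.RiemannHypothesis.RiemannHypothesis.Theorems.Splittings.RobinFiniteE3

end
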